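import Summits.AtomisticToContinuum.Crystallization.Theses.NashClassCertificates
import Summits.AtomisticToContinuum.Crystallization.Theorems.NashClassCertificatesNashTwoShellGapNashSeparation
import HarnessLib

/-!
# Line `birth` for crux `NashTwoShellGap` (stmt-AtomisticToContinuum-16826) — birth skeleton (BC3)

Crux (route `NashClassCertificates`, rank 2): there is `g > 0` such that every `1/3`-separated finite
configuration `x` of `ℝ³` that is NASH for `V_LJ` (no particle lowers the energy by relocating to a
free point: `siteEnergy x i ≤ ∑_{j ≠ i} V(|y − x_j|)` for every `i` and every free `y`) satisfies
`N·e* + g·#{i : ¬ IsTwoShellGood (1/20) (47/50) 1 x i} ≤ 𝓔_LJ(x)`, `e* = ⨅_Q e(Q)` over periodic `Q`.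

## The line: SEPARATION BOOTSTRAP, then price the two defect classes of the Nash class separately —
## VACUUM-ADJACENT (exposed) bad particles and JAMMED bad particles

A bad particle `i` is EXPOSED when a hole of radius `9/10` sits within `6/5` of it
(`∃ p, |p − x_i| ≤ 6/5 ∧ ∀ j, |p − x_j| ≥ 9/10`: outer surface, steps, kinks, adatoms, walls of voids
and cracks; every convex-hull vertex is exposed), and JAMMED otherwise (icosahedral / Frank–Kasper
centres, over-coordination, strain or shear beyond the `1/20` tolerance, grain boundaries, dislocation
cores, non-Barlow registry; interiors of good crystal carry no `9/10`-hole since octahedral interstices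
have radius `≈ 0.707 a`).  On the Nash class the hole next to an exposed particle is a LEGAL RELOCATION
TARGET, so the best-response / Aufbau inequalities of the route act exactly on the exposed class, while
the jammed class is the domain of the force-balance / on-site-Hessian cuts and of the two-shell transfer
certificates (barrier `TetrahedralFrustration`).  The crux is cut along this seam:

* `stub_nashSeparation` (M) — SEPARATION BOOTSTRAP ON THE NASH CLASS: a `1/3`-separated Nash
  configuration is `1/2`-separated.  (Nash against a far free point gives `siteEnergy x i < 0`; the
  attractive part of a site energy over `1/3`-separated matter is `≤ (1/6)·∑_{r > 2^{-1/6}} r⁻⁶ ≤ 152`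
  by the cube packing count `#{j : r_ij ≤ r} ≤ (6r+1)³` and Abel summation, while a neighbour at distance
  `ρ ≤ 1/2` alone contributes `V(ρ) ≥ V(1/2) = 4096/12 − 64/6 > 330`; so `ρ > 1/2`.  The physical value is
  `≈ 0.97`; `1/2` is what one crude step certifies and all that the other stubs assume.)
* `stub_exposedBadGap` (L/XL) — EXPOSED-BAD GAP ON THE NASH CLASS: some `g > 0` with
  `N·e* + g·#{i bad and exposed} ≤ 𝓔(x)` for every `1/2`-separated Nash `x`.  The Nash-class,
  fixed-radius, two-shell cousin of `ExposedSitesCost` (stmt-5287, routes SurfaceTensionFirst/NoFoam: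
  ground states, `∃ r₀ ∀ R`): exposed particles carry a pointwise half-bond surplus (`≥ 3` missing first
  neighbours, `≈ 0.1` each above `e*`), and the statement is "surface tension is positive at two-shell
  resolution" plus the `g = 0` floor behind the surface; why it might fail = over-bound (`Z ≥ 13`)
  sub-surface sheets offsetting the exposed deficit, i.e. the floor must be exact at `e*` in a jammed bulk.
* `stub_jammedBadGap` (XL, hardest) — JAMMED-BAD GAP ON THE NASH CLASS: some `g > 0` with
  `N·e* + g·#{i bad and not exposed} ≤ 𝓔(x)` for every `1/2`-separated Nash `x`.  This is where the
  crux's own risk lives (a tetrahedrally close-packed periodic LJ equilibrium or icosahedral glass tied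
  with hcp inside the certificate error; residually stressed good crystal just past the tolerance) and
  where the intended Nash-lifted two-shell transfer certificates (LP on decorated fans with force-balance
  and Hessian multipliers, interval-certified) are to be run.
* `NashTwoShellGap_of` — the kernel-checked composition: bootstrap `1/3 → 1/2`; the bad set is the
  disjoint union of its exposed and jammed parts, so with `g := min g_S g_F / 2`,
  `N e* + g·#bad ≤ ½(N e* + g_S #exposed-bad) + ½(N e* + g_F #jammed-bad) ≤ 𝓔(x)`.

Both gap stubs are CONSEQUENCES of the crux (smaller counts, smaller configuration class) and neither
gives it alone (a planar monolayer is all exposed, a bulk Frank–Kasper chunk is almost all jammed); the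
bootstrap is used by both.  Signatures are fully inlined one-liners over tree declarations
(`siteEnergy`, `lennardJones`, `interactionEnergy`, `PeriodicConfiguration.energyPerParticle`,
`IsTwoShellGood`); the Nash clause is the crux's, verbatim.

Disproof.lean: none exists for this crux (`ledger crux ls stmt-AtomisticToContinuum-16826`: no workfiles,
2026-08-17).  Sister-crux disproof files honoured: `CoerciveTwoShellGap/Disproof.lean`
(`coerciveTwoShellGap_false_without_sep` — every stub keeps a separation hypothesis;
`not_coerciveTwoShellGapTol_of_nonpos` — tolerance `1/20` kept; `g_le_of_gapAt` — `g` existential and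
small; `gapAt_zero` — the `g = 0` floor is free, so the content of both gap stubs is the linear term),
`FarFieldGapR/Disproof.lean` and `NearFieldConvexity/Disproof.lean` (ray / comb witnesses live at
separation `→ 0` with fixed boundary radii: here `δ` is fixed, the bootstrap bounds the density, and no
subset / boundary-charge structure is asserted).  Negatives index (20 entries, 4 in this sub: 15929,
17253, 4146, 3506) checked: no stub is a shell census, a linear-in-mismatch pricing, a local-Hales
inference or a gluing statement.

BC3 probes (registrar's folder `bc/*_probe_*.lean`): for each stub `S`, `example : S → NashTwoShellGap`
and `example : S → _root_.Crystallization` by `first | exact? | simpa | aesop` FAIL (see `Lines/birth.md`).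
-/

noncomputable section

namespace Summit.AtomisticToContinuum.Crystallization.Cruxes.NashTwoShellGap.Birth

open scoped BigOperators

/-! ## Registered stubs (sorries live ONLY here; signatures fully inlined, one line each) -/

/-- **STUB 0 — separation bootstrap on the Nash class** (size M; CLOSED 2026-08-17: landed as
`Theorems.NashTwoShellGapNashSeparation.stub_nashSeparation`, p158426, cited below).  Every `1/3`-separated finite
configuration of `ℝ³` that is Nash for `V_LJ` is `1/2`-separated.  Why true: testing the Nash inequality
of particle `i` against a free point `y` farther than `1` from everybody gives `siteEnergy x i < 0`
(`N ≥ 2`); the attractive part of `siteEnergy x i` is at most `(1/6)∑_{j : r_ij > 2^{-1/6}} r_ij⁻⁶ ≤ 152`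
for `1/3`-separated `x` (packing count `(6r+1)³` + Abel summation), every other term is `≥ 0`, and a
neighbour at distance `ρ ≤ 1/2` contributes `V(ρ) ≥ V(1/2) > 330`.  Leans on:
`card_le_of_separated_of_dist_le`, `lennardJones`, `siteEnergy`; cf. `third_le_dist_of_isGroundState`
(the ground-state version with constant `1/3`). -/
theorem stub_nashSeparation : ∀ (N : ℕ) (x : Fin N → EuclideanSpace ℝ (Fin 3)), (∀ i j : Fin N, i ≠ j → 1 / 3 ≤ dist (x i) (x j)) → (∀ (i : Fin N) (y : EuclideanSpace ℝ (Fin 3)), (∀ j : Fin N, j ≠ i → y ≠ x j) → Literature.MathematicalPhysics.StatisticalMechanics.siteEnergy Literature.MathematicalPhysics.StatisticalMechanics.lennardJones x i ≤ ∑ j ∈ Finset.univ.erase i, Literature.MathematicalPhysics.StatisticalMechanics.lennardJones (dist y (x j))) → ∀ i j : Fin N, i ≠ j → 1 / 2 ≤ dist (x i) (x j) :=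
  Summit.AtomisticToContinuum.Crystallization.Theorems.NashTwoShellGapNashSeparation.stub_nashSeparation

/-- **STUB 1 — exposed-bad gap on the Nash class** (size L/XL).  There is `g > 0` such that every
`1/2`-separated Nash configuration `x` of `N` points satisfies
`N·e* + g·#{i : ¬ IsTwoShellGood (1/20) (47/50) 1 x i ∧ ∃ p, |p − x_i| ≤ 6/5 ∧ ∀ j, |p − x_j| ≥ 9/10} ≤ 𝓔(x)`:
bad particles next to a hole (outer surface, steps, kinks, adatoms, void and crack walls) cost `g` each
above the periodic infimum.  A consequence of the crux (smaller count); the Nash-class, fixed-radius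
cousin of `ExposedSitesCost` (stmt-5287).  Why plausibly true: an exposed particle misses `≥ 3` first
neighbours (half-bond surplus `≈ 0.1` each above `e*`) and, on the Nash class, its hole is a legal
relocation target, so Aufbau `max_k siteEnergy x k ≤ ∑_{j} V(|p − x_j|)` prices it; behind the surface
only the `g = 0` floor is needed.  Why it might fail: over-bound `Z ≥ 13` sub-surface sheets offsetting
the exposed deficit (the floor must be exact at `e*` inside a jammed bulk). -/
theorem stub_exposedBadGap : ∃ g : ℝ, 0 < g ∧ ∀ (N : ℕ) (x : Fin N → EuclideanSpace ℝ (Fin 3)), (∀ i j : Fin N, i ≠ j → 1 / 2 ≤ dist (x i) (x j)) → (∀ (i : Fin N) (y : EuclideanSpace ℝ (Fin 3)), (∀ j : Fin N, j ≠ i → y ≠ x j) → Literature.MathematicalPhysics.StatisticalMechanics.siteEnergy Literature.MathematicalPhysics.StatisticalMechanics.lennardJones x i ≤ ∑ j ∈ Finset.univ.erase i, Literature.MathematicalPhysics.StatisticalMechanics.lennardJones (dist y (x j))) → (N : ℝ) * (⨅ Q : Literature.MathematicalPhysics.StatisticalMechanics.PeriodicConfiguration 3, Q.energyPerParticle Literature.MathematicalPhysics.StatisticalMechanics.lennardJones)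 + g * (Nat.card {i : Fin N // ¬ Literature.Geometry.DiscreteGeometry.IsTwoShellGood (1 / 20) (47 / 50) 1 x i ∧ ∃ p : EuclideanSpace ℝ (Fin 3), dist p (x i) ≤ 6 / 5 ∧ ∀ j : Fin N, 9 / 10 ≤ dist p (x j)} : ℝ) ≤ Literature.MathematicalPhysics.StatisticalMechanics.interactionEnergy Literature.MathematicalPhysics.StatisticalMechanics.lennardJones x := by
  sorry

/-- **STUB 2 — jammed-bad gap on the Nash class** (size XL; hardest).  There is `g > 0` such that
every `1/2`-separated Nash configuration `x` of `N` points satisfies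
`N·e* + g·#{i : ¬ IsTwoShellGood (1/20) (47/50) 1 x i ∧ ¬ ∃ p, |p − x_i| ≤ 6/5 ∧ ∀ j, |p − x_j| ≥ 9/10} ≤ 𝓔(x)`:
bad particles with no hole nearby (icosahedral / Frank–Kasper centres, over-coordination, strain or
shear past the tolerance, grain boundaries, dislocation cores, non-Barlow registry) cost `g` each.  A
consequence of the crux (smaller count); the frustration half, where the Nash-lifted two-shell transfer
certificates (force balance `F_i = 0`, on-site Hessian `H_i ⪰ 0`, best responses; LP on decorated fans,
interval-certified against the periodic infimum by cut-and-paste) are to be run.  Why it might fail =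
why the crux might: a tetrahedrally close-packed periodic LJ equilibrium (A15/σ/approximant) or a stable
icosahedral glass tied with hcp inside the certificate error, or residually stressed good crystal just
past the `1/20` tolerance at cost `~c/400`. -/
theorem stub_jammedBadGap : ∃ g : ℝ, 0 < g ∧ ∀ (N : ℕ) (x : Fin N → EuclideanSpace ℝ (Fin 3)), (∀ i j : Fin N, i ≠ j → 1 / 2 ≤ dist (x i) (x j)) → (∀ (i : Fin N) (y : EuclideanSpace ℝ (Fin 3)), (∀ j : Fin N, j ≠ i → y ≠ x j) → Literature.MathematicalPhysics.StatisticalMechanics.siteEnergy Literature.MathematicalPhysics.StatisticalMechanics.lennardJones x i ≤ ∑ j ∈ Finset.univ.erase i, Literature.MathematicalPhysics.StatisticalMechanics.lennardJones (dist y (x j))) → (N : ℝ) * (⨅ Q : Literature.MathematicalPhysics.StatisticalMechanics.PeriodicConfiguration 3, Q.energyPerParticle Literature.MathematicalPhysics.StatisticalMechanics.lennardJones) + g * (Nat.card {i : Fin N // ¬ Literature.Geometry.DiscreteGeometry.IsTwoShellGood (1 / 20) (47 / 50) 1 x i ∧ ¬ ∃ p : EuclideanSpace ℝ (Fin 3),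 dist p (x i) ≤ 6 / 5 ∧ ∀ j : Fin N, 9 / 10 ≤ dist p (x j)} : ℝ) ≤ Literature.MathematicalPhysics.StatisticalMechanics.interactionEnergy Literature.MathematicalPhysics.StatisticalMechanics.lennardJones x := by
  sorry

/-! ## Counting helper (sorry-free) -/

/-- A subtype of `Fin N` splits along any second predicate: `#{B} = #{B ∧ E} + #{B ∧ ¬E}`. [folklore] -/
theorem natCard_split {N : ℕ} (B E : Fin N → Prop) :
    Nat.card {i : Fin N // B i} = Nat.card {i : Fin N // B i ∧ E i} + Nat.card {i : Fin N // B i ∧ ¬ E i} := by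
  classical
  calc Nat.card {i : Fin N // B i}
      = Nat.card ({a : {i : Fin N // B i} // E a.1} ⊕ {a : {i : Fin N // B i} // ¬ E a.1}) :=
        Nat.card_congr (Equiv.sumCompl (fun a : {i : Fin N // B i} => E a.1)).symm
    _ = Nat.card {a : {i : Fin N // B i} // E a.1} + Nat.card {a : {i : Fin N // B i} // ¬ E a.1} :=
        Nat.card_sum
    _ = Nat.card {i : Fin N // B i ∧ E i} + Nat.card {i : Fin N // B i ∧ ¬ E i} := by
        rw [Nat.card_congr (Equiv.subtypeSubtypeEquivSubtypeInter B E),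
          Nat.card_congr (Equiv.subtypeSubtypeEquivSubtypeInter B (fun i => ¬ E i))]

/-! ## The composition (kernel-checked, no `sorry` outside the stubs) -/

/-- **`birth` — the crux BY NAME from the three stub STATEMENTS** (taken as hypotheses, so that the
registered stubs are exactly the open obligations): bootstrap the separation from `1/3` to `1/2`, split
the bad set into its exposed and jammed parts (a disjoint union, pure counting), and average the two gap
inequalities with `g := min g_S g_F / 2`. -/
theorem NashTwoShellGap_of : (∀ (N : ℕ) (x : Fin N → EuclideanSpace ℝ (Fin 3)), (∀ i j : Fin N, i ≠ j → 1 / 3 ≤ dist (x i) (x j)) → (∀ (i : Fin N) (y : EuclideanSpace ℝ (Fin 3)), (∀ j : Fin N, j ≠ i → y ≠ x j) → Literature.MathematicalPhysics.StatisticalMechanics.siteEnergy Literature.MathematicalPhysics.StatisticalMechanics.lennardJones x i ≤ ∑ j ∈ Finset.univ.erase i, Literature.MathematicalPhysics.StatisticalMechanics.lennardJones (dist y (x j))) → ∀ i j : Fin N, i ≠ j → 1 / 2 ≤ dist (x i) (x j)) → (∃ g : ℝ, 0 < g ∧ ∀ (N : ℕ) (x : Fin N → EuclideanSpace ℝ (Fin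 3)), (∀ i j : Fin N, i ≠ j → 1 / 2 ≤ dist (x i) (x j)) → (∀ (i : Fin N) (y : EuclideanSpace ℝ (Fin 3)), (∀ j : Fin N, j ≠ i → y ≠ x j) → Literature.MathematicalPhysics.StatisticalMechanics.siteEnergy Literature.MathematicalPhysics.StatisticalMechanics.lennardJones x i ≤ ∑ j ∈ Finset.univ.erase i, Literature.MathematicalPhysics.StatisticalMechanics.lennardJones (dist y (x j))) → (N : ℝ) * (⨅ Q : Literature.MathematicalPhysics.StatisticalMechanics.PeriodicConfiguration 3, Q.energyPerParticle Literature.MathematicalPhysics.StatisticalMechanics.lennardJones) + g * (Nat.card {i : Fin N // ¬ Literature.Geometry.DiscreteGeometry.IsTwoShellGood (1 / 20) (47 / 50) 1 x i ∧ ∃ p : EuclideanSpace ℝ (Fin 3), dist p (x i) ≤ 6 / 5 ∧ ∀ j : Fin N, 9 / 10 ≤ dist p (x j)} : ℝ) ≤ Literature.MathematicalPhysics.StatisticalMechanics.interactionEnergy Literature.MathematicalPhysics.StatisticalMechanics.lennardJones x) → (∃ g : ℝ, 0 < g ∧ ∀ (N : ℕ) (x : Fin N → EuclideanSpace ℝ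 (Fin 3)), (∀ i j : Fin N, i ≠ j → 1 / 2 ≤ dist (x i) (x j)) → (∀ (i : Fin N) (y : EuclideanSpace ℝ (Fin 3)), (∀ j : Fin N, j ≠ i → y ≠ x j) → Literature.MathematicalPhysics.StatisticalMechanics.siteEnergy Literature.MathematicalPhysics.StatisticalMechanics.lennardJones x i ≤ ∑ j ∈ Finset.univ.erase i, Literature.MathematicalPhysics.StatisticalMechanics.lennardJones (dist y (x j))) → (N : ℝ) * (⨅ Q : Literature.MathematicalPhysics.StatisticalMechanics.PeriodicConfiguration 3, Q.energyPerParticle Literature.MathematicalPhysics.StatisticalMechanics.lennardJones) + g * (Nat.card {i : Fin N // ¬ Literature.Geometry.DiscreteGeometry.IsTwoShellGood (1 / 20) (47 / 50) 1 x i ∧ ¬ ∃ p : EuclideanSpace ℝ (Fin 3), dist p (x i) ≤ 6 / 5 ∧ ∀ j : Fin N, 9 / 10 ≤ dist p (x j)} : ℝ) ≤ Literature.MathematicalPhysics.StatisticalMechanics.interactionEnergy Literature.MathematicalPhysics.StatisticalMechanics.lennardJones x) → Summit.AtomisticToContinuum.Crystallization.Theses.NashClassCertificates.NashTwoShellGap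 := by
  intro hsep hS hF
  obtain ⟨gS, hgS, hS⟩ := hS
  obtain ⟨gF, hgF, hF⟩ := hF
  unfold Summit.AtomisticToContinuum.Crystallization.Theses.NashClassCertificates.NashTwoShellGap
  refine ⟨min gS gF / 2, div_pos (lt_min hgS hgF) two_pos, ?_⟩
  intro N x h3 hnash
  have h2 : ∀ i j : Fin N, i ≠ j → 1 / 2 ≤ dist (x i) (x j) := hsep N x h3 hnash
  have eS := hS N x h2 hnash
  have eF := hF N x h2 hnash
  -- (1) counting: the bad set is the disjoint union of its exposed and jammed parts
  have hnat : Nat.card {i : Fin N // ¬ Literature.Geometry.DiscreteGeometry.IsTwoShellGood (1 / 20) (47 / 50) 1 x i} =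
      Nat.card {i : Fin N // ¬ Literature.Geometry.DiscreteGeometry.IsTwoShellGood (1 / 20) (47 / 50) 1 x i ∧ ∃ p : EuclideanSpace ℝ (Fin 3), dist p (x i) ≤ 6 / 5 ∧ ∀ j : Fin N, 9 / 10 ≤ dist p (x j)} +
      Nat.card {i : Fin N // ¬ Literature.Geometry.DiscreteGeometry.IsTwoShellGood (1 / 20) (47 / 50) 1 x i ∧ ¬ ∃ p : EuclideanSpace ℝ (Fin 3), dist p (x i) ≤ 6 / 5 ∧ ∀ j : Fin N, 9 / 10 ≤ dist p (x j)} :=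
    natCard_split _ _
  have hsplit : (Nat.card {i : Fin N // ¬ Literature.Geometry.DiscreteGeometry.IsTwoShellGood (1 / 20) (47 / 50) 1 x i} : ℝ) =
      (Nat.card {i : Fin N // ¬ Literature.Geometry.DiscreteGeometry.IsTwoShellGood (1 / 20) (47 / 50) 1 x i ∧ ∃ p : EuclideanSpace ℝ (Fin 3), dist p (x i) ≤ 6 / 5 ∧ ∀ j : Fin N, 9 / 10 ≤ dist p (x j)} : ℝ) +
      (Nat.card {i : Fin N // ¬ Literature.Geometry.DiscreteGeometry.IsTwoShellGood (1 / 20) (47 / 50) 1 x i ∧ ¬ ∃ p : EuclideanSpace ℝ (Fin 3), dist p (x i) ≤ 6 / 5 ∧ ∀ j : Fin N, 9 / 10 ≤ dist p (x j)} : ℝ) := by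
    exact_mod_cast hnat
  -- (2) the two gap inequalities, averaged with `g = min g_S g_F / 2`
  have hBS : (0 : ℝ) ≤ (Nat.card {i : Fin N // ¬ Literature.Geometry.DiscreteGeometry.IsTwoShellGood (1 / 20) (47 / 50) 1 x i ∧ ∃ p : EuclideanSpace ℝ (Fin 3), dist p (x i) ≤ 6 / 5 ∧ ∀ j : Fin N, 9 / 10 ≤ dist p (x j)} : ℝ) :=
    Nat.cast_nonneg _
  have hBF : (0 : ℝ) ≤ (Nat.card {i : Fin N // ¬ Literature.Geometry.DiscreteGeometry.IsTwoShellGood (1 / 20) (47 / 50) 1 x i ∧ ¬ ∃ p : EuclideanSpace ℝ (Fin 3), dist p (x i) ≤ 6 / 5 ∧ ∀ j : Fin N, 9 / 10 ≤ dist p (x j)} : ℝ) :=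
    Nat.cast_nonneg _
  have m1 := mul_le_mul_of_nonneg_right (min_le_left gS gF) hBS
  have m2 := mul_le_mul_of_nonneg_right (min_le_right gS gF) hBF
  rw [hsplit]
  linarith [m1, m2, eS, eF]

/-- **The crux BY NAME from the registered stubs** (type literally the route decl; the only `sorry`s in
its cone are `stub_nashSeparation`, `stub_exposedBadGap`, `stub_jammedBadGap`). -/
theorem NashTwoShellGap_of_stubs : Summit.AtomisticToContinuum.Crystallization.Theses.NashClassCertificates.NashTwoShellGap :=
  NashTwoShellGap_of stub_nashSeparation stub_exposedBadGap stub_jammedBadGap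

end Summit.AtomisticToContinuum.Crystallization.Cruxes.NashTwoShellGap.Birth

end
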